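import Mathlib
import Summits.Ventures.PercRepro.TriangleCapBandNoGap

/-!
# PercRepro — THE VALUES OF THE DEEP WITNESS FAMILY ON `4 + (s − t)` VERTICES (p3, gen 54; part 283)

The deep witness family of part 282 has the doubled band value `t(t−1) − (D(D−1) + c₂(c₂−1) + c₃(c₃−1) + 6 α + 2 β)`
with `c₂ + c₃ = u = t − D`, `c₃ ≤ c₂ ≤ D`, `α ≤ c₃`, `α + β ≤ c₂`.  Write `halfColl u c₂ = C(c₂,2) + C(u − c₂,2)`.
The row counts `3 α + β` fill `[0, c₂ + 2 c₃]` entirely, except the value `3 c₃ − 1` at the balanced split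
`c₂ = c₃` (`exists_rows`); the step `halfColl u (c₂ + 1) + (u − c₂ − 1) = halfColl u c₂ + c₂` (`halfColl_succ`)
makes consecutive splits overlap, and the chain lemma of part 268 gives **every `y` from `halfColl u ⌈u/2⌉` to
`halfColl u D + 2 u − D`**, except `halfColl u D + 2 u − D − 1` when `u = 2 D` (the balanced split IS the top split
`(D, D)`), as `halfColl u c₂ + 3 α + β` (`deep_three_values`).  Bridges to the tree's vocabulary:
`twoW 3 u = u(u+1) − coll u (lfRR 2 0)` for `2 ≤ u`, `deepTop t 2 u = 2 u (t − u − 1) + twoW 3 u`, and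
`coll u (lfRR 2 0) = 2 halfColl u ⌈u/2⌉` (the balanced split is the round robin over two carriers).
Axioms: standard.
-/

namespace PercRepro

namespace TriangleCap

namespace C047

open Finset

/-- The row counts `3 α + β` fill `[0, c₂ + 2 c₃]` (`c₃ ≤ c₂`), except `3 c₃ − 1` when `c₂ = c₃`. -/
theorem exists_rows (c₂ c₃ m : ℕ) (h : c₃ ≤ c₂) (hm : m ≤ c₂ + 2 * c₃) (hne : c₂ = c₃ → m + 1 ≠ 3 * c₃) :
    ∃ α β, α ≤ c₃ ∧ α + β ≤ c₂ ∧ 3 * α + β = m := by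
  by_cases hmc : m ≤ c₂
  · exact ⟨0, m, by omega, by omega, by omega⟩
  · refine ⟨(m - c₂ + 1) / 2, m - 3 * ((m - c₂ + 1) / 2), by omega, by omega, by omega⟩

/-- Half the collision count of the split `(c₂, u − c₂)`: `C(c₂,2) + C(u − c₂,2)`. -/
def halfColl (u c₂ : ℕ) : ℕ := (c₂ * (c₂ - 1) + (u - c₂) * (u - c₂ - 1)) / 2

/-- `2 halfColl u c₂ = c₂ (c₂ − 1) + (u − c₂)(u − c₂ − 1)`. -/
theorem two_mul_halfColl (u c₂ : ℕ) :
    2 * halfColl u c₂ = c₂ * (c₂ - 1) + (u - c₂) * (u - c₂ - 1) := by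
  unfold halfColl
  rw [Nat.two_mul_div_two_of_even]
  exact (Nat.even_mul_pred_self c₂).add (Nat.even_mul_pred_self (u - c₂))

/-- The step of `halfColl`: `halfColl u (c₂ + 1) + (u − c₂ − 1) = halfColl u c₂ + c₂` for `c₂ < u`. -/
theorem halfColl_succ (u c₂ : ℕ) (h : c₂ < u) :
    halfColl u (c₂ + 1) + (u - c₂ - 1) = halfColl u c₂ + c₂ := by
  have h1 := two_mul_halfColl u c₂
  have h2 := two_mul_halfColl u (c₂ + 1)
  obtain ⟨k, rfl⟩ : ∃ k, u = c₂ + k := ⟨u - c₂, by omega⟩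
  have e1 : c₂ + k - c₂ = k := by omega
  have e2 : c₂ + k - (c₂ + 1) = k - 1 := by omega
  rw [e1] at h1
  rw [e2] at h2
  have key : (c₂ + 1) * (c₂ + 1 - 1) + (k - 1) * (k - 1 - 1) + 2 * (k - 1) =
      c₂ * (c₂ - 1) + k * (k - 1) + 2 * c₂ := by
    have e3 : c₂ + 1 - 1 = c₂ := by omega
    rw [e3]
    rcases Nat.lt_or_ge k 2 with hk | hk
    · have hk1 : k = 1 := by omega
      subst hk1
      rcases Nat.eq_zero_or_pos c₂ with rfl | hc
      · rfl
      · obtain ⟨c', rfl⟩ : ∃ c', c₂ = c' + 1 := ⟨c₂ - 1, by omega⟩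
        have e4 : c' + 1 - 1 = c' := by omega
        rw [e4]
        ring
    · obtain ⟨k', rfl⟩ : ∃ k', k = k' + 2 := ⟨k - 2, by omega⟩
      have e5 : k' + 2 - 1 = k' + 1 := by omega
      have e6 : k' + 1 - 1 = k' := by omega
      rw [e5, e6]
      rcases Nat.eq_zero_or_pos c₂ with rfl | hc
      · ring
      · obtain ⟨c', rfl⟩ : ∃ c', c₂ = c' + 1 := ⟨c₂ - 1, by omega⟩
        have e4 : c' + 1 - 1 = c' := by omega
        rw [e4]
        ring
  omega

/-- **THE VALUES OF THE DEEP FAMILY:** for `3 ≤ D ≤ u ≤ 2 D`, every `y` from `halfColl u ⌈u/2⌉` to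
`halfColl u D + 2 u − D` — except `halfColl u D + 2 u − D − 1` when `u = 2 D` — is `halfColl u c₂ + 3 α + β` for
some `⌈u/2⌉ ≤ c₂ ≤ D`, `α ≤ u − c₂`, `α + β ≤ c₂`. -/
theorem deep_three_values (u D y : ℕ) (hD : 3 ≤ D) (hDu : D ≤ u) (hu : u ≤ 2 * D)
    (hlo : halfColl u ((u + 1) / 2) ≤ y) (hhi : y ≤ halfColl u D + 2 * u - D)
    (hne : u = 2 * D → y + 1 ≠ halfColl u D + 2 * u - D) :
    ∃ c₂ α β, (u + 1) / 2 ≤ c₂ ∧ c₂ ≤ D ∧ α ≤ u - c₂ ∧ α + β ≤ c₂ ∧ halfColl u c₂ + 3 * α + β = y := by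
  rcases Nat.lt_or_ge ((u + 1) / 2) D with hlt | hge
  · -- the chain over `c₂` from `⌈u/2⌉` to `D`; the parity exception at the balanced split is covered one step up
    have hI : ∀ c₂, (u + 1) / 2 ≤ c₂ → c₂ ≤ D → ∀ y, halfColl u c₂ ≤ y → y ≤ halfColl u c₂ + 2 * u - c₂ →
        ∃ c₂' α β, (u + 1) / 2 ≤ c₂' ∧ c₂' ≤ D ∧ α ≤ u - c₂' ∧ α + β ≤ c₂' ∧ halfColl u c₂' + 3 * α + β = y := by
      intro c₂ hc1 hc2 y hy1 hy2
      by_cases hpar : c₂ = u - c₂ ∧ y + 1 = halfColl u c₂ + 3 * (u - c₂)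
      · have hstep := halfColl_succ u c₂ (by omega)
        have hc2' : c₂ < D := by omega
        obtain ⟨α, β, hα, hαβ, hsum⟩ := exists_rows (c₂ + 1) (u - (c₂ + 1)) (y - halfColl u (c₂ + 1))
          (by omega) (by omega) (by omega)
        exact ⟨c₂ + 1, α, β, by omega, by omega, hα, hαβ, by omega⟩
      · obtain ⟨α, β, hα, hαβ, hsum⟩ := exists_rows c₂ (u - c₂) (y - halfColl u c₂) (by omega) (by omega)
          (by omega)
        exact ⟨c₂, α, β, hc1, hc2, hα, hαβ, by omega⟩
    have hov : ∀ c₂, (u + 1) / 2 ≤ c₂ → c₂ < D →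
        halfColl u (c₂ + 1) ≤ halfColl u c₂ + 2 * u - c₂ + 1 := by
      intro c₂ hc1 hc2
      have := halfColl_succ u c₂ (by omega)
      omega
    exact chain_attained (fun y => ∃ c₂ α β, (u + 1) / 2 ≤ c₂ ∧ c₂ ≤ D ∧ α ≤ u - c₂ ∧ α + β ≤ c₂ ∧
        halfColl u c₂ + 3 * α + β = y) (fun c₂ => halfColl u c₂) (fun c₂ => halfColl u c₂ + 2 * u - c₂)
      ((u + 1) / 2) D (le_of_lt hlt) hI hov y hlo hhi
  · -- `⌈u/2⌉ = D`: the single split `(D, u − D)`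
    have hcD : (u + 1) / 2 = D := by omega
    obtain ⟨α, β, hα, hαβ, hsum⟩ := exists_rows D (u - D) (y - halfColl u D) (by omega) (by omega)
      (fun h => by
        have := hne (by omega)
        omega)
    rw [hcD] at hlo
    exact ⟨D, α, β, by omega, le_rfl, hα, hαβ, by omega⟩

/-- `twoW 3 u = u (u + 1) − coll u (lfRR 2 0)` for `2 ≤ u` (no room for non-leaf ends). -/
theorem twoW_three_eq (u : ℕ) (hu : 2 ≤ u) : twoW 3 u = u * (u + 1) - coll u (lfRR 2 0) := by
  unfold twoW
  have h1 : (3 : ℕ) - 1 = 2 := by norm_num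
  have h2 : 3 - 1 - u = 0 := by omega
  rw [h2, h1, mul_zero, add_zero]

/-- `deepTop t 2 u = 2 u (t − u − 1) + twoW 3 u` for `2 ≤ u`. -/
theorem deepTop_three_eq (t u : ℕ) (hu : 2 ≤ u) : deepTop t 2 u = 2 * (u * (t - u - 1)) + twoW 3 u := by
  unfold deepTop
  rw [twoW_three_eq u hu]

/-- The balanced collision count over two carriers is twice `halfColl u ⌈u/2⌉`. -/
theorem coll_lfRR_two_eq (u : ℕ) : coll u (lfRR 2 0) = 2 * halfColl u ((u + 1) / 2) := by
  rw [coll_lfRR_zero 2 u (by norm_num), two_mul_halfColl]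
  obtain ⟨q, r, hr, rfl⟩ : ∃ q r, r < 2 ∧ u = 2 * q + r :=
    ⟨u / 2, u % 2, Nat.mod_lt _ (by norm_num), (Nat.div_add_mod u 2).symm⟩
  have e1 : (2 * q + r) / 2 = q := by omega
  have e2 : (2 * q + r) % 2 = r := by omega
  rw [e1, e2]
  interval_cases r
  · have e3 : (2 * q + 0 + 1) / 2 = q := by omega
    have e4 : 2 * q + 0 - q = q := by omega
    rw [e3, e4]
    ring
  · have e3 : (2 * q + 1 + 1) / 2 = q + 1 := by omega
    have e4 : 2 * q + 1 - (q + 1) = q := by omega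
    have e5 : q + 1 - 1 = q := by omega
    rw [e3, e4, e5]
    rcases Nat.eq_zero_or_pos q with rfl | hq
    · rfl
    · obtain ⟨q', rfl⟩ : ∃ q', q = q' + 1 := ⟨q - 1, by omega⟩
      have e6 : q' + 1 - 1 = q' := by omega
      rw [e6]
      ring

end C047

end TriangleCap

end PercRepro
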